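import Mathlib
import HarnessLib
import Literature.Probability.Percolation.StaticRenormalizationTwoArms

/-!
# Birth skeleton `fat-arms-coalesce` for the crux `TwoArmFromDensity`
(piece X_A of the strategist split of `FluxFromDensity`, route `PercFluxFromDensity`)

Bond percolation on `ℤ³`, `Λ_M = box 3 M`. The crux X_A: the two-arm events
`A_{2M}(u,v) = {u ↔ ∂Λ_{2M} in Λ_{2M}} ∩ {v ↔ ∂Λ_{2M} in Λ_{2M}} ∩ {u ↮ v in Λ_{2M-1}}` (Grimmett (7.91), written
graph-free over `openConnIn`/`innerBoundary`; = `twoArm (2M) u v` on lattice configurations),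
`u, v ∈ Λ_M`, have probability `≤ ε` for all `M ≥ M₀(t, ε)`, UNIFORMLY on `{p > p_c : θ(p) ≥ t}`.

THE LINE. A failure of local uniqueness at scale `M` is a pair of ARMS passing `Λ_M → ∂Λ_{2M}` in
different clusters of `Λ_{2M-1}`. Split by VOLUME: with `vol_M(w) = |C_{Λ_{2M-1}}(w)|` the inside
cluster volume,
* STUB 1 `fatArms` — near-critical supercritical arms are voluminous: for some `κ = κ(t) > 0`, w.h.p.
  uniformly on the level set, EVERY arm `w ↔ ∂Λ_{2M}` from `w ∈ Λ_M` has `vol_M(w) ≥ κ M³`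
  (no thin long arms above `p_c` at a density-determined scale);
* STUB 2 `coalesce` — voluminous pieces coalesce: for every `κ > 0`, w.h.p. uniformly on the
  level set, any two `u, v ∈ Λ_M` with `vol_M ≥ κ M³` are joined inside `Λ_{2M-1}`
  (at most one giant per box).
Composition (kernel-checked): `TwoArms_M ⊆ FatArmsᶜ ∪ Coalesceᶜ` deterministically, then a union bound.
In the real world both stubs hold on `[p_t, 1]` (density LLN at the single point `p_t` by the
monotone coupling; finite clusters with long arms / large volume are rare — DKT 2020 Thm. 2,
Kesten–Zhang (8.65); C∞-points of `Λ_M` are inside-connected — Lemma (7.89) with constants monotone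
from `p_t`); in a jump world at least one fails ("dust connected by filaments": Zhang's zero flux),
and NEITHER is known to be equivalent to `θ(p_c) = 0` on its own.

DISPROOF USED: none exists for this new crux (no `Cruxes/TwoArmFromDensity/Disproof.lean`); guards
`0 < t`, `0 < κ`, `M₀ ≤ M` keep the small-`M` junk (where `κ M³ < 1` makes every vertex "fat") out.
-/

noncomputable section

namespace Summit.CriticalPhenomena.PercolationContinuityZ3.Cruxes.TwoArmFromDensity.FatArmsCoalesce

open MeasureTheory Filter Literature.Probability.Percolation Literature.Probability.LatticeModels
open scoped Topology

/-! ## Objects of the line -/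

/-- The bond percolation measure on `ℤ³` at parameter `p`. -/
abbrev μ (p : unitInterval) : Measure (BondConfig (Site 3)) := bondPercolation (zdGraph 3) p

/-- `p_c(ℤ³)`. -/
abbrev pc : ℝ := criticalProb (zdGraph 3) (0 : Site 3)

/-- `θ(p)`. -/
abbrev θ (p : unitInterval) : ℝ := theta (zdGraph 3) (0 : Site 3) p

/-- The inside-cluster volume `vol_M(w) = |{z : w ↔ z in Λ_{2M-1}}|` (graph-free `openConnIn`; the set lies
in `Λ_{2M-1}`, so it is finite). -/
def vol (M : ℕ) (w : Site 3) (ω : BondConfig (Site 3)) : ℕ :=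
  Set.ncard {z : Site 3 | ω ∈ openConnIn (↑(box 3 (2 * M - 1)) : Set (Site 3)) w z}

/-- The arm `w ↔ ∂Λ_{2M}` in `Λ_{2M}` (graph-free, verbatim the clause of the crux). -/
def Arm (M : ℕ) (w : Site 3) : Set (BondConfig (Site 3)) :=
  {ω | ∃ y ∈ innerBoundary (zdGraph 3) (box 3 (2 * M)), ω ∈ openConnIn (↑(box 3 (2 * M)) : Set (Site 3)) w y}

/-- The two-arms event at scale `M` (verbatim the event of the crux: on lattice configurations it is
`⋃_{u,v ∈ Λ_M} twoArm (2M) u v` of `StaticRenormalizationTwoArms`). -/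
def TwoArms (M : ℕ) : Set (BondConfig (Site 3)) :=
  {ω | ∃ u ∈ box 3 M, ∃ v ∈ box 3 M, (∃ y ∈ innerBoundary (zdGraph 3) (box 3 (2 * M)), ω ∈ openConnIn (↑(box 3 (2 * M)) : Set (Site 3)) u y) ∧
    (∃ y ∈ innerBoundary (zdGraph 3) (box 3 (2 * M)), ω ∈ openConnIn (↑(box 3 (2 * M)) : Set (Site 3)) v y) ∧
    ω ∉ openConnIn (↑(box 3 (2 * M - 1)) : Set (Site 3)) u v}

/-- STUB-1 event: every arm from `Λ_M` to `∂Λ_{2M}` is `κ M³`-voluminous inside `Λ_{2M-1}`. -/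
def FatArms (M : ℕ) (κ : ℝ) : Set (BondConfig (Site 3)) :=
  {ω | ∀ w ∈ box 3 M, ω ∈ Arm M w → κ * (M : ℝ) ^ 3 ≤ (vol M w ω : ℝ)}

/-- STUB-2 event: `κ M³`-voluminous vertices of `Λ_M` are joined inside `Λ_{2M-1}`. -/
def Coalesce (M : ℕ) (κ : ℝ) : Set (BondConfig (Site 3)) :=
  {ω | ∀ u ∈ box 3 M, ∀ v ∈ box 3 M, κ * (M : ℝ) ^ 3 ≤ (vol M u ω : ℝ) → κ * (M : ℝ) ^ 3 ≤ (vol M v ω : ℝ) →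
    ω ∈ openConnIn (↑(box 3 (2 * M - 1)) : Set (Site 3)) u v}

/-- STUB 1 statement: arms are fat, uniformly on the density level set. -/
def FatArmsFromDensity : Prop :=
  ∀ t : ℝ, 0 < t → ∃ κ : ℝ, 0 < κ ∧ ∀ ε : ℝ, 0 < ε → ∃ M₀ : ℕ, ∀ M : ℕ, M₀ ≤ M →
    ∀ p : unitInterval, pc < (p : ℝ) → t ≤ θ p → (μ p).real (FatArms M κ)ᶜ ≤ ε

/-- STUB 2 statement: fat pieces coalesce, uniformly on the density level set. -/
def CoalesceFromDensity : Prop :=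
  ∀ t : ℝ, 0 < t → ∀ κ : ℝ, 0 < κ → ∀ ε : ℝ, 0 < ε → ∃ M₀ : ℕ, ∀ M : ℕ, M₀ ≤ M →
    ∀ p : unitInterval, pc < (p : ℝ) → t ≤ θ p → (μ p).real (Coalesce M κ)ᶜ ≤ ε


/-- Stand-in for the route decl `Theses.PercFluxFromDensity.TwoArmFromDensity` (item filed 2026-08-17; body VERBATIM the route decl's,
so the two are defeq by `Iff.rfl`/delta). Used as the composition's conclusion while the farm's olean of the route module
predates the item; the strategist re-points the composition at the route decl as soon as the module is rebuilt. -/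
def TwoArmFromDensityStmt : Prop :=
  ∀ t : ℝ, 0 < t → ∀ ε : ℝ, 0 < ε → ∃ L₀ : ℕ, ∀ L : ℕ, L₀ ≤ L → ∀ p : unitInterval, Literature.Probability.Percolation.criticalProb (Literature.Probability.LatticeModels.zdGraph 3) (0 : Literature.Probability.LatticeModels.Site 3) < (p : ℝ) → t ≤ Literature.Probability.Percolation.theta (Literature.Probability.LatticeModels.zdGraph 3) (0 : Literature.Probability.LatticeModels.Site 3) p → (Literature.Probability.Percolation.bondPercolation (Literature.Probability.LatticeModels.zdGraph 3) p).real {ω | ∃ u ∈ Literature.Probability.LatticeModels.box 3 L, ∃ v ∈ Literature.Probability.LatticeModels.box 3 L, (∃ y ∈ Literature.Probability.LatticeModels.innerBoundary (Literature.Probability.LatticeModels.zdGraph 3) (Literature.Probability.LatticeModels.box 3 (2 * L)), ω ∈ Literature.Probability.Percolation.openConnIn ↑(Literature.Probability.LatticeModels.box 3 (2 * L)) u y) ∧ (∃ y ∈ Literature.Probability.LatticeModels.innerBoundary (Literature.Probability.LatticeModels.zdGraph 3) (Literature.Probability.LatticeModels.box 3 (2 * L)), ω ∈ Literature.Probability.Percolation.openConnIn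 ↑(Literature.Probability.LatticeModels.box 3 (2 * L)) v y) ∧ ω ∉ Literature.Probability.Percolation.openConnIn ↑(Literature.Probability.LatticeModels.box 3 (2 * L - 1)) u v} ≤ ε

/-! ## Registered stubs -/

/-- STUB 1 **`fatArms`**: `∀ t > 0 ∃ κ > 0 ∀ ε > 0 ∃ M₀ ∀ M ≥ M₀ ∀ p > p_c, θ(p) ≥ t →
P_p(some arm `w ↔ ∂Λ_{2M}`, `w ∈ Λ_M`, has inside volume `< κ M³`) ≤ ε`. -/
theorem stub_fatArms : FatArmsFromDensity := by
  sorry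

/-- STUB 2 **`coalesce`**: `∀ t > 0 ∀ κ > 0 ∀ ε > 0 ∃ M₀ ∀ M ≥ M₀ ∀ p > p_c, θ(p) ≥ t →
P_p(two `κM³`-voluminous vertices of `Λ_M` not joined inside `Λ_{2M-1}`) ≤ ε`. -/
theorem stub_coalesce : CoalesceFromDensity := by
  sorry

namespace Registered
/-- registered stub signature (the hypothesis type of the composition, by name) -/
abbrev stub_fatArms : Prop := FatArmsFromDensity
/-- registered stub signature -/
abbrev stub_coalesce : Prop := CoalesceFromDensity
end Registered

/-! ## Composition (no `sorry` below this line) -/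

/-- Two arms in different inside-clusters contradict fatness-plus-coalescence. [folklore] -/
theorem twoArms_subset (M : ℕ) (κ : ℝ) : TwoArms M ⊆ (FatArms M κ)ᶜ ∪ (Coalesce M κ)ᶜ := by
  rintro ω ⟨u, hu, v, hv, hau, hav, hnot⟩
  by_contra h
  simp only [Set.mem_union, Set.mem_compl_iff, not_or, not_not] at h
  obtain ⟨hfat, hco⟩ := h
  exact hnot (hco u hu v hv (hfat u hu hau) (hfat v hv hav))

/-- **Composition**: STUB 1 → STUB 2 → the crux `TwoArmFromDensity` (concluded BY NAME). [folklore] -/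
theorem TwoArmFromDensity_of (h₁ : Registered.stub_fatArms) (h₂ : Registered.stub_coalesce) :
    TwoArmFromDensityStmt := by
  intro t ht ε hε
  obtain ⟨κ, hκ, hM₁⟩ := h₁ t ht
  obtain ⟨M₁, hM₁'⟩ := hM₁ (ε / 2) (half_pos hε)
  obtain ⟨M₂, hM₂'⟩ := h₂ t ht κ hκ (ε / 2) (half_pos hε)
  refine ⟨max M₁ M₂, fun M hM p hp hpt => ?_⟩
  have hle : (μ p).real (TwoArms M) ≤ (μ p).real ((FatArms M κ)ᶜ ∪ (Coalesce M κ)ᶜ) :=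
    measureReal_mono (twoArms_subset M κ) (measure_ne_top _ _)
  have hunion : (μ p).real ((FatArms M κ)ᶜ ∪ (Coalesce M κ)ᶜ) ≤
      (μ p).real (FatArms M κ)ᶜ + (μ p).real (Coalesce M κ)ᶜ := measureReal_union_le _ _
  have h1 := hM₁' M (le_trans (le_max_left _ _) hM) p hp hpt
  have h2 := hM₂' M (le_trans (le_max_right _ _) hM) p hp hpt
  change (μ p).real (TwoArms M) ≤ ε
  linarith

end Summit.CriticalPhenomena.PercolationContinuityZ3.Cruxes.TwoArmFromDensity.FatArmsCoalesce

end
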